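import Summits.QuantumAdvantage.QuantumAdvantage.Theorems.NearExactIsExact.Negative.KThreeInvolution
import Summits.QuantumAdvantage.QuantumAdvantage.Theorems.NearExactIsExact.Negative.CornerFlatRankFourCeiling
import Summits.QuantumAdvantage.QuantumAdvantage.Theorems.CubicForrelationSignedCubicForrelationInPrBPPDefectIsotropic

/-!
# `NearExactIsExact` (stmt-QuantumAdvantage-14043) — negative lemma: THEOREM K3-INV for module pencils,
  hypothesis-minimal form (gen 45 disprover)

`KThreeInvolution.kthree_inv_empty` takes the fibre maps `K(ū)` abstractly (additive involutions with
`K(0̄) = id` and a 7-fold relation).  Here the pencil is given by its three generators: additive maps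
`G₀, G₁, G₂` on `𝔽₂^m` with `K(ū)s = s ⊕ [u₀]G₀s ⊕ [u₁]G₁s ⊕ [u₂]G₂s`, and the ONLY structural hypothesis
is that every `K(ū)` is an involution.  Then (`kthree_module_empty`) additivity, `K(0̄) = id` and the
relation `K(1,1,1)K(0,1,1)K(1,0,1)K(0,0,1)K(1,1,0)K(0,1,0)K(1,0,0) = id` are DERIVED: involutivity of
`K(e_c)` gives `G_c² = 0`, of `K(e_c ⊕ e_d)` gives `G_cG_d = G_dG_c`, and then the seven-fold product is
the identity `Π_{ū ≠ 0̄}(1 + ℓ_ū) = 1` (`ℓ_ū = Σ_{c ∈ ū} G_c`) of the commutative algebra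
`𝔽₂[G₀,G₁,G₂]/(G_c²)`, whose degree-1, 2, 3 parts cancel in pairs.  So: NO K-model over a 3-bit base
whose fibre pencil is a module over `𝔽₂[a,b,c]/(a²,b²,c²)` (equivalently: all `K(ū)` involutions)
carries a cubic pair with residual `{0̄} × A`, `A` any codimension-3 flat (any `V` with an odd 3-space),
for ANY section map `p` — one-sided, every fibre dimension `m`, census-free.

HONEST FRAMING: a kernel-checked negative lemma (the involution = module sub-family of the thin algebraic
end of the `naff = 3` stratum of BQ-11); NOT summit progress.
-/

set_option linter.dupNamespace false -- D-0017: single-problem summit ⇒ `QuantumAdvantage.QuantumAdvantage` by design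

namespace Summit.QuantumAdvantage.QuantumAdvantage.Theorems.NearExactIsExact.Negative.KThreeModule

open Finset
open Literature.Computability.QuantumComplexity
open Literature.Computability.QuantumComplexity.BuzetChailloux (bxor)
open Summit.QuantumAdvantage.QuantumAdvantage.Theorems.NearExactIsExact.Negative.SkewProductCore (ind)
open Summit.QuantumAdvantage.QuantumAdvantage.Theorems.NearExactIsExact.Negative.KThreeInvolution
  (kthree_inv_empty)
open Summit.QuantumAdvantage.QuantumAdvantage.Theorems.NearExactIsExact.Negative.CornerFlatRankFour
  (cfr_bxor_false)
open Summit.QuantumAdvantage.QuantumAdvantage.Theorems.SignedCubicForrelationInPrBPP.DirectSumDefect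
  (bxor_assoc)

/-! ### Vector xor algebra on `𝔽₂^m` -/

variable {m : ℕ}

/-- `x ⊕ x = 0`. [folklore] -/
theorem km_bxor_self (x : Fin m → Bool) : bxor x x = fun _ => false := by
  funext i; simp [bxor]

/-- `x ⊕ (x ⊕ y) = y`. [folklore] -/
theorem km_bxor_cancel (x y : Fin m → Bool) : bxor x (bxor x y) = y := by
  funext i; simp only [bxor]; cases x i <;> cases y i <;> rfl

/-- `x ⊕ y = x ⇒ y = 0`. [folklore] -/
theorem km_eq_zero_of_bxor_eq_left {x y : Fin m → Bool} (h : bxor x y = x) : y = fun _ => false := by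
  funext i
  have hi := congrFun h i
  simp only [bxor] at hi
  cases hx : x i <;> cases hy : y i <;> simp [hx, hy] at hi ⊢

/-! ### THEOREM K3-INV for module pencils -/

/-- **THEOREM K3-INV, module form.** `G₀, G₁, G₂` additive on `𝔽₂^m`, `K(ū)s = s ⊕ [u₀]G₀s ⊕ [u₁]G₁s ⊕
[u₂]G₂s` with every `K(ū)` an involution; `π(ū,s) = (ū, p(ū) ⊕ K(ū)s)` for ANY `p`; residual
`[ū = 0̄]·V(s)` with `V` of odd parity on some 3-space through `0` (every codimension-3 flat).  Then no
cubic pair `c₁ ⊕ c₂∘π` has that residual.  (`G_c² = 0` and `G_cG_d = G_dG_c` follow from involutivity;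
the seven-fold relation is the identity `Π_{ū≠0̄}(1 + ℓ_ū) = 1` in `𝔽₂[G₀,G₁,G₂]/(G_c²)`.) [folklore] -/
theorem kthree_module_empty (G : Fin 3 → (Fin m → Bool) → (Fin m → Bool))
    (hGadd : ∀ c s t, G c (bxor s t) = bxor (G c s) (G c t))
    (K : (Fin 3 → Bool) → (Fin m → Bool) → (Fin m → Bool))
    (hK : ∀ u s, K u s = bxor (bxor (bxor s (bif u 0 then G 0 s else fun _ => false))
      (bif u 1 then G 1 s else fun _ => false)) (bif u 2 then G 2 s else fun _ => false))
    (hKinv : ∀ u s, K u (K u s) = s)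
    (p : (Fin 3 → Bool) → (Fin m → Bool)) (π : (Fin (3 + m) → Bool) → (Fin (3 + m) → Bool))
    (hπ : ∀ u s, π (Fin.append u s) = Fin.append u (bxor (p u) (K u s)))
    (V : (Fin m → Bool) → Bool)
    (hV : ∃ a : Fin 3 → Fin m → Bool,
      ∑ ε : Fin 3 → Bool, ind (V fun l => decide (Odd #(univ.filter fun i => ε i && a i l))) = 1)
    (c₁ c₂ : (Fin (3 + m) → Bool) → Bool) (h₁ : IsDegLeFun 3 c₁) (h₂ : IsDegLeFun 3 c₂)
    (hres : ∀ z, (c₁ z ^^ c₂ (π z)) =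
      (decide (∀ i : Fin 3, z (Fin.castAdd m i) = false) && V (fun k => z (Fin.natAdd 3 k)))) :
    False := by
  -- `G_c 0 = 0`
  have hG0 : ∀ c, G c (fun _ => false) = fun _ => false := by
    intro c
    have h := hGadd c (fun _ => false) (fun _ => false)
    rw [km_bxor_self] at h
    exact km_eq_zero_of_bxor_eq_left h.symm
  -- additivity of `K(ū)` and `K(0̄) = id`
  have hKadd : ∀ u s t, K u (bxor s t) = bxor (K u s) (K u t) := by
    intro u s t
    rw [hK, hK, hK, hGadd, hGadd, hGadd]
    funext i
    cases u 0 <;> cases u 1 <;> cases u 2 <;> simp [Bool.xor_left_comm, Bool.xor_comm]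
  have hK0 : ∀ s, K (fun _ => false) s = s := by
    intro s
    rw [hK]
    simp only [cond_false, cfr_bxor_false]
  -- `G_c² = 0` from the involutions `K(e_c)`
  have hsq0 : ∀ s, G 0 (G 0 s) = fun _ => false := by
    intro s
    have h := hKinv ![true, false, false] s
    simp only [hK, Matrix.cons_val_zero, Matrix.cons_val_one, Matrix.cons_val_two, Matrix.head_cons,
      Matrix.tail_cons, cond_true, cond_false, cfr_bxor_false, hGadd] at h
    rw [bxor_assoc, km_bxor_cancel] at h
    exact km_eq_zero_of_bxor_eq_left h
  have hsq1 : ∀ s, G 1 (G 1 s) = fun _ => false := by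
    intro s
    have h := hKinv ![false, true, false] s
    simp only [hK, Matrix.cons_val_zero, Matrix.cons_val_one, Matrix.cons_val_two, Matrix.head_cons,
      Matrix.tail_cons, cond_true, cond_false, cfr_bxor_false, hGadd] at h
    rw [bxor_assoc, km_bxor_cancel] at h
    exact km_eq_zero_of_bxor_eq_left h
  have hsq2 : ∀ s, G 2 (G 2 s) = fun _ => false := by
    intro s
    have h := hKinv ![false, false, true] s
    simp only [hK, Matrix.cons_val_zero, Matrix.cons_val_one, Matrix.cons_val_two, Matrix.head_cons,
      Matrix.tail_cons, cond_true, cond_false, cfr_bxor_false, hGadd] at h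
    rw [bxor_assoc, km_bxor_cancel] at h
    exact km_eq_zero_of_bxor_eq_left h
  -- `G_c G_d = G_d G_c` from the involutions `K(e_c ⊕ e_d)`
  have hc10 : ∀ s, G 1 (G 0 s) = G 0 (G 1 s) := by
    intro s
    have h := hKinv ![true, true, false] s
    simp only [hK, Matrix.cons_val_zero, Matrix.cons_val_one, Matrix.cons_val_two, Matrix.head_cons,
      Matrix.tail_cons, cond_true, cond_false, cfr_bxor_false, hGadd, hsq0, hsq1] at h
    funext i
    have hi := congrFun h i
    simp only [bxor] at hi
    revert hi
    cases G 1 (G 0 s) i <;> cases G 0 (G 1 s) i <;> cases G 0 s i <;> cases G 1 s i <;>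
      cases s i <;> decide
  have hc20 : ∀ s, G 2 (G 0 s) = G 0 (G 2 s) := by
    intro s
    have h := hKinv ![true, false, true] s
    simp only [hK, Matrix.cons_val_zero, Matrix.cons_val_one, Matrix.cons_val_two, Matrix.head_cons,
      Matrix.tail_cons, cond_true, cond_false, cfr_bxor_false, hGadd, hsq0, hsq2] at h
    funext i
    have hi := congrFun h i
    simp only [bxor] at hi
    revert hi
    cases G 2 (G 0 s) i <;> cases G 0 (G 2 s) i <;> cases G 0 s i <;> cases G 2 s i <;>
      cases s i <;> decide
  have hc21 : ∀ s, G 2 (G 1 s) = G 1 (G 2 s) := by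
    intro s
    have h := hKinv ![false, true, true] s
    simp only [hK, Matrix.cons_val_zero, Matrix.cons_val_one, Matrix.cons_val_two, Matrix.head_cons,
      Matrix.tail_cons, cond_true, cond_false, cfr_bxor_false, hGadd, hsq1, hsq2] at h
    funext i
    have hi := congrFun h i
    simp only [bxor] at hi
    revert hi
    cases G 2 (G 1 s) i <;> cases G 1 (G 2 s) i <;> cases G 1 s i <;> cases G 2 s i <;>
      cases s i <;> decide
  -- the seven-fold product, in three bites: (1+a)(1+b)(1+a+b) = 1+ab, (1+c)(1+a+c) = 1+a+ac,
  -- (1+b+c)(1+a+b+c) = 1+a+ab+ac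
  have L1 : ∀ s, K ![true, true, false] (K ![false, true, false] (K ![true, false, false] s)) =
      bxor s (G 0 (G 1 s)) := by
    intro s
    simp only [hK, Matrix.cons_val_zero, Matrix.cons_val_one, Matrix.cons_val_two, Matrix.head_cons,
      Matrix.tail_cons, cond_true, cond_false, cfr_bxor_false, hGadd, hsq0, hsq1, hc10, hG0]
    funext i
    simp [bxor, Bool.xor_left_comm, Bool.xor_comm]
  have L2 : ∀ t, K ![true, false, true] (K ![false, false, true] t) =
      bxor (bxor t (G 0 t)) (G 0 (G 2 t)) := by
    intro t
    simp only [hK, Matrix.cons_val_zero, Matrix.cons_val_one, Matrix.cons_val_two, Matrix.head_cons,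
      Matrix.tail_cons, cond_true, cond_false, cfr_bxor_false, hGadd, hsq2]
    funext i
    simp [bxor, Bool.xor_left_comm, Bool.xor_comm]
  have L3 : ∀ t, K ![true, true, true] (K ![false, true, true] t) =
      bxor (bxor (bxor t (G 0 t)) (G 0 (G 1 t))) (G 0 (G 2 t)) := by
    intro t
    simp only [hK, Matrix.cons_val_zero, Matrix.cons_val_one, Matrix.cons_val_two, Matrix.head_cons,
      Matrix.tail_cons, cond_true, cond_false, hGadd, hsq1, hsq2, hc21, cfr_bxor_false]
    funext i
    simp [bxor, Bool.xor_left_comm, Bool.xor_comm]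
  refine kthree_inv_empty K hKadd hK0 hKinv
    (fun k => if k = 0 then ![true, false, false] else if k = 1 then ![false, true, false]
      else if k = 2 then ![true, true, false] else if k = 3 then ![false, false, true]
      else if k = 4 then ![true, false, true] else if k = 5 then ![false, true, true]
      else ![true, true, true]) ?_ ?_ p π hπ V hV c₁ c₂ h₁ h₂ hres
  · intro k hk
    interval_cases k <;> decide
  · intro s
    show K ![true, true, true] (K ![false, true, true] (K ![true, false, true] (K ![false, false, true]
      (K ![true, true, false] (K ![false, true, false] (K ![true, false, false] s)))))) = s
    rw [L1, L2, L3]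
    simp only [hGadd, hsq0, hc10, hc20, cfr_bxor_false]
    funext i
    simp [bxor, Bool.xor_left_comm, Bool.xor_comm]

end Summit.QuantumAdvantage.QuantumAdvantage.Theorems.NearExactIsExact.Negative.KThreeModule
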